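import Literature.NumberTheory.Automorphic.ClassFieldCharacter
import Literature.NumberTheory.GaloisRepresentations.HeckeCharacterProofs
import Mathlib.NumberTheory.RamificationInertia.Galois
import HarnessLib

/-!
# Local ideles in the idelic norm group: `⟨u⟩_v^{e_v f_v} ∈ N(𝔸_Lˣ)`, universe-polymorphic

Topic `NumberTheory/GaloisRepresentations`; namespace `Literature.NumberTheory.GaloisRepresentations`.
Everything **proved**; no definitions of new notions, no named facts.

For a finite Galois extension of number fields `L/K`, a finite place `v` of `K` and `u ∈ K_vˣ`, the
local idele `⟨u⟩_v` (`localUnits v u`: `u` at `v`, `1` elsewhere) satisfies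

* `ideleGalNorm_localUnits_eq_pow` — `N(⟨u⟩_{w₀}) = ((⟨u⟩_v)_L)^{e_v f_v}` for any `w₀ ∣ v` (the
  Galois norm `N y = ∏_σ σ • y` of `Automorphic/ClassFieldCharacter.lean`; each place above `v` is hit
  `#D_{w₀} = e_v f_v` times), the idelic shadow of `N_{L_w/K_v}(u) = u^{[L_w : K_v]}`
  (Cassels–Fröhlich II §11, VII §1.2);
* `localUnits_pow_ramificationIdxIn_mul_inertiaDegIn_mem_normGroup` — hence
  `⟨u⟩_v^{e_v f_v} ∈ Kˣ N(𝔸_Lˣ) = normGroup K L`;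
* `localUnits_pow_inertiaDeg_mem_normGroup_of_isUnramifiedIn` — at a place `v` **unramified** in
  `L`, `⟨u⟩_v^{f(𝔔|v)} ∈ normGroup K L` for every prime `𝔔` of `L` over `v` (`e_v = 1` and
  `f(𝔔|v) = f_v` for `L/K` Galois) — the input `hFrob` of the norm index dictionary
  (`NormIndexDictionary.lean`: `𝒩_{L/K}(𝔪)` dies in `J_K/Kˣ N J_L`).

These are the statements of `Automorphic/ClassFieldCharacterLocal.lean` (`ideleGalNorm_localUnits`,
`localUnits_pow_mem_normGroup`), which are proved there for `K L : Type` only; the provefact target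
`artinReciprocity_rankOne` quantifies over `K : Type u`, so the computation is redone here for
arbitrary universes (same proof: `σ • ⟨c⟩_w = ⟨σ c⟩_{σw}`, the base change of `⟨u⟩_v` is
`∏_{w ∣ v} ⟨u⟩_w`, and the fibres of `σ ↦ σ w₀` are cosets of the decomposition group, of order
`e_v f_v` by `#{w ∣ v} · e_v f_v = [L : K]`, Mathlib
`Ideal.ncard_primesOver_mul_ramificationIdxIn_mul_inertiaDegIn`).

## References

* J. W. S. Cassels, A. Fröhlich (eds.), *Algebraic Number Theory* (1967), Ch. II (Cassels) §11,
  Ch. VII (Tate) §1.1–§1.2, §6. [CasselsFrohlichANT1967]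
* N. Childress, *Class Field Theory*, Universitext, Springer 2009, Ch. 4 §2 (PDF pp. 75–80).
  [Childress2009]
-/

noncomputable section

open NumberField IsDedekindDomain

namespace Literature.NumberTheory.GaloisRepresentations

open Literature.NumberTheory.Automorphic

universe u v

section LocalNorms

variable (K : Type u) (L : Type v) [Field K] [Field L] [Algebra K L] [NumberField K] [NumberField L]

/-- `finiteAdeleSingle` is `FiniteAdeleRing.mulSingle` (both are Mathlib's `RestrictedProduct.mulSingle`).
[folklore] -/
theorem finiteAdeleSingle_eq_mulSingle' [DecidableEq (HeightOneSpectrum (𝓞 L))]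
    (w : HeightOneSpectrum (𝓞 L)) (y : w.adicCompletion L) :
    finiteAdeleSingle w y = FiniteAdeleRing.mulSingle (L := L) w y := by
  refine FiniteAdeleRing.ext L fun u => ?_
  by_cases hu : u = w
  · subst hu
    rw [finiteAdeleSingle_apply_self, FiniteAdeleRing.mulSingle_apply_self]
  · rw [finiteAdeleSingle_apply_of_ne _ hu, FiniteAdeleRing.mulSingle_apply_of_ne L _ hu]

omit [NumberField K] in
/-- **`Gal(L/K)` permutes the local ideles**: `σ • ⟨c⟩_w = ⟨σ c⟩_{σ w}` for `c ∈ L_wˣ`.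
[cite: CasselsFrohlichANT1967, Ch. VII §1.1] -/
theorem algEquiv_smul_localUnits (σ : L ≃ₐ[K] L) (w : HeightOneSpectrum (𝓞 L)) (c : (w.adicCompletion L)ˣ) :
    σ • localUnits w c = localUnits (σ • w) (galAdicCompletionUnitsEquiv (L := L) σ rfl c) := by
  classical
  refine Units.ext (Prod.ext ?_ ?_)
  · rw [AdeleRing.coe_smul_units, AdeleRing.smul_fst, localUnits_fst, localUnits_fst, smul_one]
  · rw [AdeleRing.coe_smul_units, AdeleRing.smul_snd]
    change σ • finiteAdeleSingle w (c : w.adicCompletion L) =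
      finiteAdeleSingle (σ • w)
        ((galAdicCompletionUnitsEquiv (L := L) σ rfl c : ((σ • w).adicCompletion L)ˣ) : (σ • w).adicCompletion L)
    rw [finiteAdeleSingle_eq_mulSingle', finiteAdeleSingle_eq_mulSingle', FiniteAdeleRing.smul_mulSingle]
    rfl

variable {K} in
/-- The local units of `L` above `v` attached to `u ∈ K_vˣ` (`u` viewed in `L_wˣ` for `w ∣ v`, `1` at
the places not above `v`). [folklore] -/
theorem exists_localUnitsAbove' (v : HeightOneSpectrum (𝓞 K)) (u : (v.adicCompletion K)ˣ) :
    ∃ c : ∀ w : HeightOneSpectrum (𝓞 L), (w.adicCompletion L)ˣ,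
      (∀ (w : HeightOneSpectrum (𝓞 L)) (_ : w.under (𝓞 K) = v) [w.asIdeal.LiesOver v.asIdeal],
        (c w : w.adicCompletion L) = adicCompletionOfLiesOver K L v w (u : v.adicCompletion K)) ∧
      ∀ w : HeightOneSpectrum (𝓞 L), w.under (𝓞 K) ≠ v → c w = 1 := by
  classical
  refine ⟨fun w => if h : w.under (𝓞 K) = v then
      Units.map (@adicCompletionOfLiesOver (𝓞 K) K L (𝓞 L) _ _ _ _ _ _ _ _ _ _ _ _ _ _ _ _ v w
        ⟨(congrArg HeightOneSpectrum.asIdeal h).symm⟩).toMonoidHom u else 1, ?_, ?_⟩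
  · intro w h _
    simp only [dif_pos h]
    rfl
  · intro w h
    simp only [dif_neg h]

variable {K} in
/-- **Base change of a local idele**: `(⟨u⟩_v)_L = ∏_{w ∣ v} ⟨u⟩_w`. [cite: CasselsFrohlichANT1967, Ch. II §14] -/
theorem ideleBaseChange_localUnits' (v : HeightOneSpectrum (𝓞 K)) (u : (v.adicCompletion K)ˣ)
    (c : ∀ w : HeightOneSpectrum (𝓞 L), (w.adicCompletion L)ˣ)
    (hc : ∀ (w : HeightOneSpectrum (𝓞 L)) (_ : w.under (𝓞 K) = v) [w.asIdeal.LiesOver v.asIdeal],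
      (c w : w.adicCompletion L) = adicCompletionOfLiesOver K L v w (u : v.adicCompletion K))
    (T : Finset (HeightOneSpectrum (𝓞 L))) (hT : ∀ w, w ∈ T ↔ w.under (𝓞 K) = v) :
    AdeleRing.ideleBaseChange K L (localUnits v u) = ∏ w ∈ T, localUnits w (c w) := by
  classical
  refine Units.ext (Prod.ext ?_ ?_)
  · rw [AdeleRing.coe_ideleBaseChange, AdeleRing.baseChange_fst, localUnits_fst, map_one,
      fst_prod_localUnits]
  · rw [AdeleRing.coe_ideleBaseChange, AdeleRing.baseChange_snd]
    refine FiniteAdeleRing.ext L fun w => ?_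
    rw [FiniteAdeleRing.baseChange_apply, snd_prod_localUnits]
    by_cases hw : w.under (𝓞 K) = v
    · haveI : w.asIdeal.LiesOver v.asIdeal := ⟨(congrArg HeightOneSpectrum.asIdeal hw).symm⟩
      rw [if_pos ((hT w).2 hw), hc w hw,
        adicCompletionOfUnder_eq K w hw (fun p => ((localUnits v u : (AdeleRing (𝓞 K) K)ˣ) : AdeleRing (𝓞 K) K).2 p),
        localUnits_snd_apply_self]
    · rw [if_neg (fun h => hw ((hT w).1 h)), localUnits_snd_apply_of_ne _ hw, map_one]

/-- The places of `L` above `v = w₀|_K` are the `Gal(L/K)`-conjugates of `w₀`. [cite: CasselsFrohlichANT1967, Ch. VII Prop. 1.2 (ii)] -/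
theorem mem_image_algEquiv_smul_iff' [IsGalois K L] [DecidableEq (HeightOneSpectrum (𝓞 L))]
    (w₀ w : HeightOneSpectrum (𝓞 L)) :
    w ∈ Finset.univ.image (fun σ : L ≃ₐ[K] L => σ • w₀) ↔ w.under (𝓞 K) = w₀.under (𝓞 K) := by
  rw [Finset.mem_image]
  constructor
  · rintro ⟨σ, -, rfl⟩
    exact HeightOneSpectrum.under_algEquiv_smul (F := K) (E := L) σ w₀
  · intro h
    obtain ⟨σ, hσ⟩ := HeightOneSpectrum.exists_algEquiv_smul_eq (F := K) h.symm
    exact ⟨σ, Finset.mem_univ _, hσ⟩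

/-- The fibres of `σ ↦ σ • w₀` all have `#Stab(w₀)` elements. [folklore] -/
theorem card_filter_algEquiv_smul_eq' [DecidableEq (HeightOneSpectrum (𝓞 L))] (w₀ : HeightOneSpectrum (𝓞 L))
    (τ : L ≃ₐ[K] L) :
    (Finset.univ.filter fun σ : L ≃ₐ[K] L => σ • w₀ = τ • w₀).card =
      Nat.card (MulAction.stabilizer (L ≃ₐ[K] L) w₀) := by
  classical
  rw [Nat.card_eq_fintype_card, Fintype.card_subtype]
  have himage : (Finset.univ.filter fun σ : L ≃ₐ[K] L => σ • w₀ = τ • w₀) =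
      (Finset.univ.filter fun σ : L ≃ₐ[K] L => σ ∈ MulAction.stabilizer (L ≃ₐ[K] L) w₀).image
        (τ * ·) := by
    ext σ
    simp only [Finset.mem_filter, Finset.mem_univ, true_and, Finset.mem_image,
      MulAction.mem_stabilizer_iff]
    constructor
    · intro h
      refine ⟨τ⁻¹ * σ, ?_, by rw [mul_inv_cancel_left]⟩
      rw [mul_smul, h, inv_smul_smul]
    · rintro ⟨s, hs, rfl⟩
      rw [mul_smul, hs]
  rw [himage, Finset.card_image_of_injective _ (mul_right_injective τ)]

omit [NumberField K] [NumberField L] in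
/-- `#{w ∣ v} = #(primes of 𝓞 L over v)`. [folklore] -/
theorem natCard_placesOver_eq_ncard_primesOver (v : HeightOneSpectrum (𝓞 K)) :
    Nat.card {w : HeightOneSpectrum (𝓞 L) // w.under (𝓞 K) = v} = (v.asIdeal.primesOver (𝓞 L)).ncard := by
  rw [← Nat.card_coe_set_eq]
  refine Nat.card_congr
    { toFun := fun w => ⟨w.1.asIdeal, w.1.isPrime, ⟨(congrArg HeightOneSpectrum.asIdeal w.2).symm⟩⟩
      invFun := fun P => ⟨⟨P.1, P.2.1, Ideal.ne_bot_of_mem_primesOver v.ne_bot P.2⟩,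
        HeightOneSpectrum.ext P.2.2.over.symm⟩
      left_inv := fun w => by ext1; rfl
      right_inv := fun P => by rfl }

/-- **The decomposition group has order `e_v f_v`**: `#Stab(w₀) = e_v f_v` for `L/K` Galois and
`w₀ ∣ v` (orbit–stabiliser and `#{w ∣ v} · e_v f_v = [L : K]`). [cite: CasselsFrohlichANT1967, Ch. VII §1.2] -/
theorem card_stabilizer_algEquiv_eq [IsGalois K L] (w₀ : HeightOneSpectrum (𝓞 L)) :
    Nat.card (MulAction.stabilizer (L ≃ₐ[K] L) w₀) =
      (w₀.under (𝓞 K)).asIdeal.ramificationIdxIn (𝓞 L) * (w₀.under (𝓞 K)).asIdeal.inertiaDegIn (𝓞 L) := by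
  classical
  set v := w₀.under (𝓞 K) with hv
  have h1 := (MulAction.stabilizer (L ≃ₐ[K] L) w₀).index_mul_card
  have h2 : (MulAction.stabilizer (L ≃ₐ[K] L) w₀).index = (v.asIdeal.primesOver (𝓞 L)).ncard := by
    rw [MulAction.index_stabilizer, ← natCard_placesOver_eq_ncard_primesOver (K := K) (L := L) v,
      ← Nat.card_coe_set_eq]
    refine Nat.card_congr (Equiv.subtypeEquivRight fun w => ?_)
    rw [MulAction.mem_orbit_iff]
    constructor
    · rintro ⟨σ, rfl⟩
      exact HeightOneSpectrum.under_algEquiv_smul (F := K) (E := L) σ w₀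
    · intro h
      exact HeightOneSpectrum.exists_algEquiv_smul_eq (F := K) (Eq.symm h)
  have h3 := Ideal.ncard_primesOver_mul_ramificationIdxIn_mul_inertiaDegIn v.asIdeal (𝓞 L) (L ≃ₐ[K] L)
  rw [h2] at h1
  rw [← h1] at h3
  have hpos : (v.asIdeal.primesOver (𝓞 L)).ncard ≠ 0 := by
    intro h0
    rw [h0, zero_mul] at h1
    exact Nat.card_pos.ne' h1.symm
  exact (Nat.eq_of_mul_eq_mul_left (Nat.pos_of_ne_zero hpos) h3).symm

variable {K} in
/-- **The Galois norm of a local idele above `v`**: `N(⟨u⟩_{w₀}) = ∏_σ ⟨u⟩_{σ w₀} = ((⟨u⟩_v)_L)^{e_v f_v}`,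
the idelic form of `N_{L_w/K_v}(u) = u^{[L_w : K_v]}` for `u ∈ K_v`. [cite: CasselsFrohlichANT1967, Ch. VII §1.2] -/
theorem ideleGalNorm_localUnits_eq_pow [IsGalois K L] (v : HeightOneSpectrum (𝓞 K)) (u : (v.adicCompletion K)ˣ)
    (c : ∀ w : HeightOneSpectrum (𝓞 L), (w.adicCompletion L)ˣ)
    (hc : ∀ (w : HeightOneSpectrum (𝓞 L)) (_ : w.under (𝓞 K) = v) [w.asIdeal.LiesOver v.asIdeal],
      (c w : w.adicCompletion L) = adicCompletionOfLiesOver K L v w (u : v.adicCompletion K))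
    {w₀ : HeightOneSpectrum (𝓞 L)} (hw₀ : w₀.under (𝓞 K) = v) :
    AdeleRing.ideleGalNorm K L (localUnits w₀ (c w₀)) =
      AdeleRing.ideleBaseChange K L (localUnits v u) ^
        (v.asIdeal.ramificationIdxIn (𝓞 L) * v.asIdeal.inertiaDegIn (𝓞 L)) := by
  classical
  -- `σ • ⟨c_{w₀}⟩ = ⟨c_{σ w₀}⟩`
  have hsmul : ∀ σ : L ≃ₐ[K] L, σ • localUnits w₀ (c w₀) = localUnits (σ • w₀) (c (σ • w₀)) := by
    intro σ
    rw [algEquiv_smul_localUnits]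
    congr 1
    refine Units.ext ?_
    haveI : w₀.asIdeal.LiesOver v.asIdeal := ⟨(congrArg HeightOneSpectrum.asIdeal hw₀).symm⟩
    have hσ : (σ • w₀).under (𝓞 K) = v := by
      rw [HeightOneSpectrum.under_algEquiv_smul (F := K) (E := L) σ w₀, hw₀]
    haveI : (σ • w₀).asIdeal.LiesOver v.asIdeal := ⟨(congrArg HeightOneSpectrum.asIdeal hσ).symm⟩
    change galAdicCompletionMap σ rfl (c w₀ : w₀.adicCompletion L) = (c (σ • w₀) : (σ • w₀).adicCompletion L)
    rw [hc w₀ hw₀, hc (σ • w₀) hσ, galAdicCompletionMap_adicCompletionOfLiesOver K σ v rfl]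
  -- regroup `∏_σ` along the fibres of `σ ↦ σ • w₀`
  set T : Finset (HeightOneSpectrum (𝓞 L)) := Finset.univ.image (fun σ : L ≃ₐ[K] L => σ • w₀) with hTdef
  have hT : ∀ w, w ∈ T ↔ w.under (𝓞 K) = v := fun w => by
    rw [hTdef, mem_image_algEquiv_smul_iff', hw₀]
  rw [AdeleRing.ideleGalNorm_apply]
  simp_rw [hsmul]
  rw [Finset.prod_comp (fun w => localUnits w (c w)) (fun σ : L ≃ₐ[K] L => σ • w₀)]
  have hfib : ∀ w ∈ T, (Finset.univ.filter fun σ : L ≃ₐ[K] L => σ • w₀ = w).card =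
      v.asIdeal.ramificationIdxIn (𝓞 L) * v.asIdeal.inertiaDegIn (𝓞 L) := by
    intro w hw
    obtain ⟨τ, -, rfl⟩ := Finset.mem_image.1 hw
    have h := card_filter_algEquiv_smul_eq' K L w₀ τ
    rw [card_stabilizer_algEquiv_eq, hw₀] at h
    convert h using 2
  rw [Finset.prod_congr rfl fun w hw => by rw [hfib w hw], Finset.prod_pow,
    ideleBaseChange_localUnits' L v u c hc T hT]

variable {K} in
/-- **Local norms lie in the group of norms: `⟨u⟩_v^{e_v f_v} ∈ N(𝔸_Lˣ)`** for `L/K` Galois, every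
finite place `v` of `K` and `u ∈ K_vˣ`. [cite: CasselsFrohlichANT1967, Ch. VII §1.2] -/
theorem localUnits_pow_ramificationIdxIn_mul_inertiaDegIn_mem_idelicNormSubgroup [IsGalois K L]
    (v : HeightOneSpectrum (𝓞 K)) (u : (v.adicCompletion K)ˣ) :
    localUnits v u ^ (v.asIdeal.ramificationIdxIn (𝓞 L) * v.asIdeal.inertiaDegIn (𝓞 L)) ∈
      idelicNormSubgroup K L := by
  obtain ⟨w₀, hw₀⟩ := HeightOneSpectrum.under_surjective (A := 𝓞 K) (B := 𝓞 L) v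
  obtain ⟨c, hc, -⟩ := exists_localUnitsAbove' L v u
  exact ⟨localUnits w₀ (c w₀), by rw [map_pow, ideleGalNorm_localUnits_eq_pow L v u c hc hw₀]⟩

variable {K} in
/-- `⟨u⟩_v^{e_v f_v} ∈ Kˣ N(𝔸_Lˣ)`. [folklore] -/
theorem localUnits_pow_ramificationIdxIn_mul_inertiaDegIn_mem_normGroup [IsGalois K L]
    (v : HeightOneSpectrum (𝓞 K)) (u : (v.adicCompletion K)ˣ) :
    localUnits v u ^ (v.asIdeal.ramificationIdxIn (𝓞 L) * v.asIdeal.inertiaDegIn (𝓞 L)) ∈ normGroup K L :=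
  idelicNormSubgroup_le_normGroup K L
    (localUnits_pow_ramificationIdxIn_mul_inertiaDegIn_mem_idelicNormSubgroup L v u)

variable {K} in
/-- **At an unramified place, `⟨u⟩_v^{f(𝔔|v)}` is a norm**: for `L/K` Galois, `v` unramified in `L`
and `𝔔` a prime of `L` over `v`, `⟨u⟩_v^{f(𝔔|v)} ∈ Kˣ N(𝔸_Lˣ)` (`e_v = 1`, `f(𝔔|v) = f_v`).  In
particular `⟨ϖ_v⟩^{f_v}`, the idele of `N_{L/K} 𝔔 = v^{f_v}`, is in the norm group: the hypothesis
`hFrob` of `NormIndexDictionary.lean`. [cite: Childress2009, Ch. 4 §2 (PDF pp. 75–80)] -/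
theorem localUnits_pow_inertiaDeg_mem_normGroup_of_isUnramifiedIn [IsGalois K L]
    (v : HeightOneSpectrum (𝓞 K)) (hv : Algebra.IsUnramifiedIn (𝓞 L) v.asIdeal)
    {Q : Ideal (𝓞 L)} (hQ : Q ∈ v.asIdeal.primesOver (𝓞 L)) (u : (v.adicCompletion K)ˣ) :
    localUnits v u ^ Q.inertiaDeg (𝓞 K) ∈ normGroup K L := by
  haveI := hQ.1
  haveI := hQ.2
  have he : v.asIdeal.ramificationIdxIn (𝓞 L) = 1 := by
    rw [Ideal.ramificationIdxIn_eq_ramificationIdx v.asIdeal Q (L ≃ₐ[K] L)]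
    exact hv.ramificationIdx_eq_one hQ.2
  have hf : Q.inertiaDeg (𝓞 K) = v.asIdeal.inertiaDegIn (𝓞 L) := by
    rw [Ideal.inertiaDegIn_eq_inertiaDeg v.asIdeal Q (L ≃ₐ[K] L)]
  have h := localUnits_pow_ramificationIdxIn_mul_inertiaDegIn_mem_normGroup L v u
  rwa [he, one_mul, ← hf] at h

end LocalNorms

end Literature.NumberTheory.GaloisRepresentations
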